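import Mathlib.Tactic.Group
import Mathlib.Tactic.Abel
import Summits.MatrixMultiplication.MatrixMultiplication.Theses.GelfandPairHosts
import Summits.MatrixMultiplication.MatrixMultiplication.Theorems.GelfandHosting.Negative.AbelianIndex
import Summits.MatrixMultiplication.MatrixMultiplication.Theorems.GelfandPairHostsKillGlue

/-!
# `GelfandHosting` (crux stmt-MatrixMultiplication-7381), line `birth`, stub `stub_saturatedTripleHosts`:
# capacity against a commuting abelian action with `q` orbits

Negative-side support file of the line lead (2026-08-17); `sorry`-free, no new definitions.

**The commuting-action bound.**  Let `G ↷ X` be the host and let an (additively written) abelian group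
`C` act on `X` commuting with `G` (`g • (c +ᵥ x) = c +ᵥ g • x`), its orbits presented by any labelling
`blk : X → Y`, base points `b : Y → X` and coordinates `κ : X → C` with `κ x +ᵥ b (blk x) = x`
(so `q = |Y|` bounds the number of orbits used).  Then every quotient-form design has
`|F|·|Hs|·|P| ≤ q²·|X|` (`commutingAction_quotientDesign_capacity`): the map
`(f, h, p) ↦ (blk (f • p), blk (h • p), (κ (f • p) - κ (h • p)) +ᵥ p)` into `Y × Y × X` is injective by
the design condition.  The same holds for stabiliser-saturated TPP triples
(`commutingAction_saturatedTriple_capacity`).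

Instances (with the obvious labelling): `C = G` for an abelian regular host (`q = 1`: Cohn–Umans 2003
Lemma 3.1, `abc ≤ N`); `C = A` acting on the second factor of a product host `(K × A) ↷ Y × A`
(`q = |Y|`, the bound of `Negative/BlockProduct`); `C =` the DIAGONAL copy of `A` for every wreath host
`A ≀ K ↷ A × [q]`, `K ≤ S_q` arbitrary (bound `q² N` while `D ≈ q N` and the base group has index `|K|`
up to `q!` — the family left open by the abelian-index and block-product obstructions); in general `C` =
any abelian subgroup of the automorphism group `N_G(H)/H` of the transitive `G`-set `X = G/H` (it acts
freely, `q = N/|C|`), giving `abc ≤ N³/|C|²`.  So a stub-3 (or free-base-set crux) witness needs, besides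
`D ≤ N^{1+o(1)}` and no abelian subgroup of `G` of index `< N^{1/4-o(1)}`, that `N_G(H)/H` has no
abelian subgroup of order `> N^{3/4+o(1)}`.
-/

-- the tree's namespace `Summit.MatrixMultiplication.MatrixMultiplication.…` repeats a component by design
set_option linter.dupNamespace false

namespace Summit.MatrixMultiplication.MatrixMultiplication.Theorems.GelfandHosting.Negative

/-- **Commuting-action capacity bound (quotient form).** Let `G` act on `X` and let an abelian group
`C` act additively on `X` commuting with `G` (`g • (c +ᵥ x) = c +ᵥ g • x`); let `blk : X → Y`,
`b : Y → X`, `κ : X → C` satisfy `κ x +ᵥ b (blk x) = x`.  Every quotient-form design `(F, Hs, P)` —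
`(f'⁻¹ f h⁻¹ h') • p = p' ⇒ f = f' ∧ h = h' ∧ p = p'` — satisfies `|F|·|Hs|·|P| ≤ |Y|²·|X|`:
the map `(f,h,p) ↦ (blk (f • p), blk (h • p), (κ (f • p) - κ (h • p)) +ᵥ p)` is injective, because a
collision makes `f'⁻¹ f h⁻¹ h'` carry `p` to `p'` (move the `C`-coordinates through `G` by
commutation).  With `C = G` abelian regular and `Y` a point this is Cohn–Umans 2003, Lemma 3.1.
[folklore] -/
theorem commutingAction_quotientDesign_capacity {G X Y C : Type} [Group G] [MulAction G X]
    [AddCommGroup C] [AddAction C X] [Fintype X] [Fintype Y] [DecidableEq X] [DecidableEq Y]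
    (blk : X → Y) (b : Y → X) (κ : X → C) (hrec : ∀ x, κ x +ᵥ b (blk x) = x)
    (hcommute : ∀ (g : G) (c : C) (x : X), g • (c +ᵥ x) = c +ᵥ g • x)
    (F Hs : Finset G) (P : Finset X)
    (hdes : ∀ f ∈ F, ∀ f' ∈ F, ∀ h ∈ Hs, ∀ h' ∈ Hs, ∀ p ∈ P, ∀ p' ∈ P,
      (f'⁻¹ * f * h⁻¹ * h') • p = p' → f = f' ∧ h = h' ∧ p = p') :
    F.card * Hs.card * P.card ≤ Fintype.card Y ^ 2 * Fintype.card X := by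
  classical
  -- two points with the same label differ by the difference of their coordinates
  have tr : ∀ x x' : X, blk x = blk x' → x' = (κ x' - κ x) +ᵥ x := by
    intro x x' hxx
    have hB : b (blk x) = -κ x +ᵥ x := eq_neg_vadd_iff.mpr (hrec x)
    calc x' = κ x' +ᵥ b (blk x') := (hrec x').symm
      _ = κ x' +ᵥ (-κ x +ᵥ x) := by rw [← hxx, hB]
      _ = (κ x' - κ x) +ᵥ x := by rw [vadd_vadd, ← sub_eq_add_neg]
  let Ψ : G × G × X → Y × Y × X :=
    fun t => (blk (t.1 • t.2.2), blk (t.2.1 • t.2.2), (κ (t.1 • t.2.2) - κ (t.2.1 • t.2.2)) +ᵥ t.2.2)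
  have hinj : Set.InjOn Ψ ↑(F ×ˢ (Hs ×ˢ P)) := by
    rintro ⟨f, h, p⟩ hm ⟨f', h', p'⟩ hm' heq
    simp only [Finset.coe_product, Set.mem_prod, Finset.mem_coe] at hm hm'
    obtain ⟨hf, hh, hp⟩ := hm
    obtain ⟨hf', hh', hp'⟩ := hm'
    simp only [Ψ, Prod.mk.injEq] at heq
    obtain ⟨e1, e2, e3⟩ := heq
    have th : h' • p' = (κ (h' • p') - κ (h • p)) +ᵥ h • p := tr _ _ e2
    have tf : f' • p' = (κ (f' • p') - κ (f • p)) +ᵥ f • p := tr _ _ e1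
    -- `p` is a `C`-translate of `p'`
    set δ : C := (κ (f • p) - κ (h • p)) - (κ (f' • p') - κ (h' • p')) with hδ
    have tp : p = -δ +ᵥ p' := by
      rw [eq_neg_vadd_iff, hδ, sub_eq_add_neg _ (κ (f' • p') - κ (h' • p')), add_comm, ← vadd_vadd,
        e3, neg_vadd_vadd]
    -- the element `f'⁻¹ f h⁻¹ h'` carries `p` to `p'`
    have key : (f'⁻¹ * f * h⁻¹ * h') • p = p' := by
      have hC : -δ + (κ (h' • p') - κ (h • p)) = κ (f' • p') - κ (f • p) := by
        rw [hδ]; abel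
      calc (f'⁻¹ * f * h⁻¹ * h') • p
          = f'⁻¹ • f • h⁻¹ • h' • (-δ +ᵥ p') := by rw [← tp]; simp only [mul_smul]
        _ = f'⁻¹ • f • h⁻¹ • (-δ +ᵥ h' • p') := by rw [hcommute h']
        _ = f'⁻¹ • f • h⁻¹ • (-δ +ᵥ ((κ (h' • p') - κ (h • p)) +ᵥ h • p)) := by rw [← th]
        _ = f'⁻¹ • f • h⁻¹ • ((κ (f' • p') - κ (f • p)) +ᵥ h • p) := by rw [vadd_vadd, hC]
        _ = f'⁻¹ • f • ((κ (f' • p') - κ (f • p)) +ᵥ h⁻¹ • h • p) := by rw [hcommute h⁻¹]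
        _ = f'⁻¹ • f • ((κ (f' • p') - κ (f • p)) +ᵥ p) := by rw [inv_smul_smul]
        _ = f'⁻¹ • ((κ (f' • p') - κ (f • p)) +ᵥ f • p) := by rw [hcommute f]
        _ = f'⁻¹ • f' • p' := by rw [← tf]
        _ = p' := inv_smul_smul f' p'
    obtain ⟨r1, r2, r3⟩ := hdes f hf f' hf' h hh h' hh' p hp p' hp' key
    subst r1 r2 r3
    rfl
  calc F.card * Hs.card * P.card
      = (F ×ˢ (Hs ×ˢ P)).card := by rw [Finset.card_product, Finset.card_product, mul_assoc]
    _ = ((F ×ˢ (Hs ×ˢ P)).image Ψ).card := (Finset.card_image_of_injOn hinj).symm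
    _ ≤ Fintype.card (Y × Y × X) := Finset.card_le_univ _
    _ = Fintype.card Y ^ 2 * Fintype.card X := by
        simp only [Fintype.card_prod]; ring

/-- **Commuting-action capacity bound for saturated TPP triples.** In the setting of
`commutingAction_quotientDesign_capacity`, a TPP triple `(S,T,U)` of `G` whose third leg is
right-saturated by the stabiliser of `x₀` satisfies `|S|·|T|·|U • x₀| ≤ |Y|²·|X|`. [folklore] -/
theorem commutingAction_saturatedTriple_capacity {G X Y C : Type} [Group G] [MulAction G X]
    [AddCommGroup C] [AddAction C X] [Fintype X] [Fintype Y] [DecidableEq X] [DecidableEq Y]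
    (blk : X → Y) (b : Y → X) (κ : X → C) (hrec : ∀ x, κ x +ᵥ b (blk x) = x)
    (hcommute : ∀ (g : G) (c : C) (x : X), g • (c +ᵥ x) = c +ᵥ g • x) (x₀ : X) (S T U : Finset G)
    (htpp : ∀ s ∈ S, ∀ s' ∈ S, ∀ t ∈ T, ∀ t' ∈ T, ∀ u ∈ U, ∀ u' ∈ U,
      s * s'⁻¹ * (t * t'⁻¹) * (u * u'⁻¹) = 1 → s = s' ∧ t = t' ∧ u = u')
    (hsat : ∀ u ∈ U, ∀ h : G, h • x₀ = x₀ → u * h ∈ U) :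
    S.card * T.card * (U.image fun u => u • x₀).card ≤ Fintype.card Y ^ 2 * Fintype.card X := by
  classical
  have h := commutingAction_quotientDesign_capacity blk b κ hrec hcommute (S.image (·⁻¹))
    (T.image (·⁻¹)) (U.image (· • x₀)) (quotientDesign_of_saturatedTriple x₀ S T U htpp hsat)
  rwa [Finset.card_image_of_injective _ inv_injective,
    Finset.card_image_of_injective _ inv_injective] at h

/-! ## Generous transitivity forces the `G`-automorphisms of `X` to be involutions

For a transitive `G`-set `X = G/H` the natural commuting group is `Aut_G(X) ≅ N_G(H)/H` (acting freely,
its orbit through `x₀` being the set of `H`-fixed points).  In the setting of `stub_saturatedTripleHosts`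
the host is GENEROUSLY transitive, and then every element of `N_G(H)` squares into `H`: `N_G(H)/H` is an
elementary abelian `2`-group, so `commutingAction_quotientDesign_capacity` applies to ALL of it
(`C = N_G(H)/H`, `q = N/|Fix_X(H)|`), giving `abc ≤ N·(N/|Fix_X(H)|)²` — a stub-3 witness needs
`|Fix_X(H)| ≤ N^{3/4+o(1)}` (the transvection hosts have `|Fix(H)| = N/2`). -/

/-- **Normalising elements square into the stabiliser** in a generously transitive action: if every pair
of points is swapped by some group element and `n` normalises `H = G_{x₀}`, then `n² ∈ H`.  (Swap `x₀`
with `n • x₀` by `g = n h`, `h ∈ H`; then `x₀ = g • n • x₀ = n • h • n • x₀ = n • n • x₀` because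
`n⁻¹ h n ∈ H`.)  Hence `N_G(H)/H` has exponent `2` and is abelian. [folklore] -/
theorem sq_smul_eq_of_generouslyTransitive {G X : Type*} [Group G] [MulAction G X]
    (hgt : ∀ x y : X, ∃ g : G, g • x = y ∧ g • y = x) (x₀ : X) (n : G)
    (hn : ∀ h : G, h • x₀ = x₀ → (n⁻¹ * h * n) • x₀ = x₀) :
    (n * n) • x₀ = x₀ := by
  obtain ⟨g, hg1, hg2⟩ := hgt x₀ (n • x₀)
  -- `h := n⁻¹ g` fixes `x₀`
  have hh : (n⁻¹ * g) • x₀ = x₀ := by rw [mul_smul, hg1, inv_smul_smul]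
  -- so does `n⁻¹ h n = n⁻¹ (n⁻¹ g) n`
  have hh' : (n⁻¹ * (n⁻¹ * g) * n) • x₀ = x₀ := hn _ hh
  calc (n * n) • x₀ = (n * n) • ((n⁻¹ * (n⁻¹ * g) * n) • x₀) := by rw [hh']
    _ = (g * n) • x₀ := by rw [← mul_smul]; congr 1; group
    _ = x₀ := by rw [mul_smul, hg2]

/-- **`N_G(H)/H` has exponent two** (subgroup form): in a generously transitive action, every element of
the normaliser of the stabiliser `H = G_{x₀}` has its square in `H`. [folklore] -/
theorem sq_mem_stabilizer_of_mem_normalizer {G X : Type*} [Group G] [MulAction G X]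
    (hgt : ∀ x y : X, ∃ g : G, g • x = y ∧ g • y = x) (x₀ : X) (n : G)
    (hn : n ∈ Subgroup.normalizer (MulAction.stabilizer G x₀ : Set G)) :
    n * n ∈ MulAction.stabilizer G x₀ := by
  rw [MulAction.mem_stabilizer_iff]
  refine sq_smul_eq_of_generouslyTransitive hgt x₀ n fun h hh => ?_
  have hmem : h ∈ MulAction.stabilizer G x₀ := hh
  -- `n⁻¹ h n ∈ H` since `n` normalises `H`
  have := (Subgroup.mem_normalizer_iff''.mp hn h).mp hmem
  exact this

/-! ## The commuting-action bound for GENERAL module-TPP designs (crux level)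

Unlike the abelian-index obstruction, the commuting-action injection survives the passage from
quotient-form designs to general designs `(φ, ψ, χ)` with NO freeness assumption on the base sets: a
collision of `(i,j,k) ↦ (blk χ(i,k), blk ψ(j,k), (κ χ(i,k) - κ ψ(j,k)) +ᵥ ψ(j₀,k))` makes column `k'`
of `ψ` a `C`-translate of column `k` (transport elements commute with `C`), and then
`φ(i,j) • ψ(j',k) = χ(i',k')`, which the design forbids unless `(i,j,k) = (i',j',k')`.  So the bound
`abc ≤ q²·N` holds for every design in the crux `GelfandHosting`, e.g. `abc ≤ 4N` for ALL designs in a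
transvection / wreath host `A ≀ C₂` (`q = 2` via the diagonal translations), and `abc ≤ N` for all
designs in an abelian regular host. -/

/-- **Commuting-action capacity bound for general designs.** Let `G` act on `X` and let an abelian
group `C` act additively on `X` commuting with `G`, with orbit presentation `κ x +ᵥ base (blk x) = x`
(`blk : X → Y`).  Then every module-TPP design `φ : [a]×[b] → G`, `ψ : [b]×[c] → X`, `χ : [a]×[c] → X`
(`φ(i,j) • ψ(j',k) = χ(i',k') ↔ (i,j,k) = (i',j',k')`) has `a·b·c ≤ |Y|²·|X|`. [folklore] -/
theorem commutingAction_design_capacity {G X Y C : Type} [Group G] [MulAction G X]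
    [AddCommGroup C] [AddAction C X] [Fintype X] [Fintype Y] [DecidableEq X] [DecidableEq Y]
    (blk : X → Y) (base : Y → X) (κ : X → C) (hrec : ∀ x, κ x +ᵥ base (blk x) = x)
    (hcommute : ∀ (g : G) (c : C) (x : X), g • (c +ᵥ x) = c +ᵥ g • x)
    {a b c : ℕ} (φ : Fin a × Fin b → G) (ψ : Fin b × Fin c → X) (χ : Fin a × Fin c → X)
    (hdes : ∀ (i i' : Fin a) (j j' : Fin b) (k k' : Fin c),
      φ (i, j) • ψ (j', k) = χ (i', k') ↔ (i = i' ∧ j = j' ∧ k = k')) :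
    a * b * c ≤ Fintype.card Y ^ 2 * Fintype.card X := by
  classical
  -- trivial when there is no column
  rcases Nat.eq_zero_or_pos b with hb | hb
  · subst hb; simp
  let j₀ : Fin b := ⟨0, hb⟩
  -- two points with the same label differ by the difference of their coordinates
  have tr : ∀ x x' : X, blk x = blk x' → x' = (κ x' - κ x) +ᵥ x := by
    intro x x' hxx
    have hB : base (blk x) = -κ x +ᵥ x := eq_neg_vadd_iff.mpr (hrec x)
    calc x' = κ x' +ᵥ base (blk x') := (hrec x').symm
      _ = κ x' +ᵥ (-κ x +ᵥ x) := by rw [← hxx, hB]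
      _ = (κ x' - κ x) +ᵥ x := by rw [vadd_vadd, ← sub_eq_add_neg]
  -- the diagonal of the design and the transport elements
  have diag : ∀ (i : Fin a) (j : Fin b) (k : Fin c), φ (i, j) • ψ (j, k) = χ (i, k) :=
    fun i j k => (hdes i i j j k k).mpr ⟨rfl, rfl, rfl⟩
  have transport : ∀ (i : Fin a) (j : Fin b) (k : Fin c),
      ((φ (i, j₀))⁻¹ * φ (i, j)) • ψ (j, k) = ψ (j₀, k) := by
    intro i j k
    rw [mul_smul, diag, ← diag i j₀ k, inv_smul_smul]
  let Ψ : Fin a × Fin b × Fin c → Y × Y × X :=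
    fun t => (blk (χ (t.1, t.2.2)), blk (ψ (t.2.1, t.2.2)),
      (κ (χ (t.1, t.2.2)) - κ (ψ (t.2.1, t.2.2))) +ᵥ ψ (j₀, t.2.2))
  have hinj : Function.Injective Ψ := by
    rintro ⟨i, j, k⟩ ⟨i', j', k'⟩ heq
    simp only [Ψ, Prod.mk.injEq] at heq
    obtain ⟨e1, e2, e3⟩ := heq
    have t1 : χ (i', k') = (κ (χ (i', k')) - κ (χ (i, k))) +ᵥ χ (i, k) := tr _ _ e1
    have t2 : ψ (j', k') = (κ (ψ (j', k')) - κ (ψ (j, k))) +ᵥ ψ (j, k) := tr _ _ e2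
    set δ : C := (κ (χ (i, k)) - κ (ψ (j, k))) - (κ (χ (i', k')) - κ (ψ (j', k'))) with hδ
    -- column `k'` of the base row is the `δ`-translate of column `k`
    have t3 : ψ (j₀, k') = δ +ᵥ ψ (j₀, k) := by
      have h1 : -(κ (χ (i', k')) - κ (ψ (j', k'))) +ᵥ ((κ (χ (i, k)) - κ (ψ (j, k))) +ᵥ ψ (j₀, k))
          = ψ (j₀, k') := by rw [e3, neg_vadd_vadd]
      rw [← h1, vadd_vadd, hδ, neg_add_eq_sub]
    -- hence so is column `k'` of row `j'` (transport commutes with `C`)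
    have t4 : ψ (j', k') = δ +ᵥ ψ (j', k) := by
      have u1 : ψ (j', k') = ((φ (i, j₀))⁻¹ * φ (i, j'))⁻¹ • ψ (j₀, k') :=
        eq_inv_smul_iff.mpr (transport i j' k')
      have u2 : ψ (j', k) = ((φ (i, j₀))⁻¹ * φ (i, j'))⁻¹ • ψ (j₀, k) :=
        eq_inv_smul_iff.mpr (transport i j' k)
      rw [u1, t3, hcommute, ← u2]
    -- compare with `t2`: `ψ(j',k)` is the `α`-translate of `ψ(j,k)`, `α = κ χ(i',k') - κ χ(i,k)`
    have t5 : ψ (j', k) = (κ (χ (i', k')) - κ (χ (i, k))) +ᵥ ψ (j, k) := by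
      have h2 : ψ (j', k) = -δ +ᵥ ((κ (ψ (j', k')) - κ (ψ (j, k))) +ᵥ ψ (j, k)) := by
        rw [← t2, eq_neg_vadd_iff, ← t4]
      rw [h2, vadd_vadd]
      congr 1
      rw [hδ]; abel
    -- therefore `φ(i,j) • ψ(j',k) = χ(i',k')`, which the design forbids unless the triples agree
    have key : φ (i, j) • ψ (j', k) = χ (i', k') := by
      rw [t5, hcommute, diag, ← t1]
    obtain ⟨r1, r2, r3⟩ := (hdes i i' j j' k k').mp key
    subst r1 r2 r3
    rfl
  have h := Fintype.card_le_of_injective Ψ hinj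
  simpa [Fintype.card_prod, Fintype.card_fin, mul_assoc, mul_comm, mul_left_comm, pow_two] using h

/-- **Witness shape for the crux (commuting-action form).** Let `(G ↷ X, φ, ψ, χ)` satisfy the
`∃`-body of `GelfandHosting` at exponent `ε` — multiplicity-free host, module-TPP design of size
`(a,b,c)` with `c ≥ 1`, `D = dim span{P_g} ≤ (abc)^{(2+ε)/3}` — and let an abelian group `C` act on
`X` commuting with `G`, with an orbit presentation using `q = |Y|` labels.  Then `N³ ≤ (q²·N)^{2+ε}`
(`N = |X|`), i.e. `N^{1-ε} ≤ q^{4+2ε}`: multiplicity-free ⇒ transitive ⇒ `N ≤ D ≤ (abc)^{(2+ε)/3}` and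
`abc ≤ q² N` (`commutingAction_design_capacity`).  For the wreath / transvection hosts (`q = 2`) this
reads `N^{1-ε} ≤ 2^{4+2ε}`; for an abelian commuting action with `q = N^{o(1)}` orbits no `ε < 1` is
reachable asymptotically. [folklore] -/
theorem gelfandHosting_witness_commutingAction {G X Y C : Type} [Group G] [Fintype G]
    [MulAction G X] [AddCommGroup C] [AddAction C X] [Fintype X] [Fintype Y] [DecidableEq X]
    [DecidableEq Y] (blk : X → Y) (base : Y → X) (κ : X → C) (hrec : ∀ x, κ x +ᵥ base (blk x) = x)
    (hcommute : ∀ (g : G) (c : C) (x : X), g • (c +ᵥ x) = c +ᵥ g • x)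
    {a b c : ℕ} (φ : Fin a × Fin b → G) (ψ : Fin b × Fin c → X) (χ : Fin a × Fin c → X)
    (j₀ : Fin b) (k₀ : Fin c) (ε : ℝ) (hε : 0 < ε)
    (hmf : ∀ A A' : Matrix X X ℂ, (∀ (g : G) (x y : X), A (g • x) (g • y) = A x y) →
      (∀ (g : G) (x y : X), A' (g • x) (g • y) = A' x y) → A * A' = A' * A)
    (hdes : ∀ (i i' : Fin a) (j j' : Fin b) (k k' : Fin c),
      φ (i, j) • ψ (j', k) = χ (i', k') ↔ (i = i' ∧ j = j' ∧ k = k'))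
    (hD : (Module.finrank ℂ (Submodule.span ℂ (Set.range fun g : G =>
        Matrix.of fun y x : X => if g • x = y then (1 : ℂ) else 0)) : ℝ) ≤
      ((a * b * c : ℕ) : ℝ) ^ ((2 + ε) / 3)) :
    (Fintype.card X : ℝ) ^ (3 : ℝ) ≤ ((Fintype.card Y ^ 2 * Fintype.card X : ℕ) : ℝ) ^ (2 + ε) := by
  have htrans : ∀ x y : X, ∃ g : G, g • x = y :=
    Summit.MatrixMultiplication.MatrixMultiplication.Theorems.killGlue_transitive_of_comm hmf
  have hN : (Fintype.card X : ℝ) ≤ (Module.finrank ℂ (Submodule.span ℂ (Set.range fun g : G =>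
      Matrix.of fun y x : X => if g • x = y then (1 : ℂ) else 0)) : ℝ) := by
    exact_mod_cast Summit.MatrixMultiplication.MatrixMultiplication.Theorems.killGlue_card_le_finrank
      (ψ (j₀, k₀)) htrans
  have hcap : ((a * b * c : ℕ) : ℝ) ≤ ((Fintype.card Y ^ 2 * Fintype.card X : ℕ) : ℝ) := by
    exact_mod_cast commutingAction_design_capacity blk base κ hrec hcommute φ ψ χ hdes
  have hexp : 0 ≤ (2 + ε) / 3 := by positivity
  have h1 : (Fintype.card X : ℝ) ≤ ((Fintype.card Y ^ 2 * Fintype.card X : ℕ) : ℝ) ^ ((2 + ε) / 3) :=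
    hN.trans (hD.trans (Real.rpow_le_rpow (by positivity) hcap hexp))
  have h2 := Real.rpow_le_rpow (by positivity) h1 (show (0 : ℝ) ≤ 3 by norm_num)
  rw [← Real.rpow_mul (by positivity)] at h2
  have e : (2 + ε) / 3 * 3 = 2 + ε := by ring
  rwa [e] at h2

end Summit.MatrixMultiplication.MatrixMultiplication.Theorems.GelfandHosting.Negative
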